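import Mathlib.NumberTheory.SumTwoSquares
import Summits.AnomalousDissipation.AnomalousDissipation.Theorems.MomentParityQuarticGateAxialQuadSteps

/-!
# Axial quadratic rigidity (stub S2q of line `axis-sectors`, crux `MomentParity.QuarticGate`):
# off-centre axial sectors, part A — kills, the equilateral obstruction, and the lens `θ ∈ ball`

Blocks `Q a b` with `a + b = θ`, `θ = (0, m, 0) ≠ 0` an AXIAL momentum, must vanish. Part A:

* `kill_step` — the propagation rule: in `(POL)(k₁, k₂, b)`, if the two companion blocks
  `Q (k₁+b) k₂`, `Q (k₂+b) k₁` vanish (dead or absent) and `(k₁, k₂)` is an unequal non-collinear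
  pair, then `Q (k₁+k₂) b = 0` (block-killing lemma);
* `no_equilateral_on_axis` — `a + b = θ` with `|a| = |b| = |θ|` is impossible on the axis
  (`x² + z² = 3 j²` has no solution with `j ≠ 0`; A0 of the line's skeleton, re-proved here);
* `offcentre_noncollinear_of_mem` — for `θ` itself in the punctured ball (`m² ≤ N²`, `m > 0`), every
  block of a NON-COLLINEAR pair dies, by downward induction on the exteriority `|2a - θ|²` with the
  two-mode links `(POL)(-b, θ, b)`: a link conducts unless `|b| = |θ|`, and a two-sided stall would
  be an equilateral pair.
-/

namespace Summit.AnomalousDissipation.AnomalousDissipation.Theorems.MomentParityQuarticGate.AxialQuad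

open Matrix

-- `Summit.<Summit>.<Problem>` is the tree's mandated summit-side namespace (CONVENTIONS §2); for this
-- single-conjunct summit the two coincide, so the duplicate is deliberate.
set_option linter.dupNamespace false

variable (Q : (Fin 3 → ℤ) → (Fin 3 → ℤ) → Matrix (Fin 3) (Fin 3) ℂ) {N : ℕ}

/-- **The propagation rule.** In `(POL)(k₁, k₂, b)` with dead companions, an unequal non-collinear
pair `(k₁, k₂)` kills the block `Q (k₁ + k₂) b`. [folklore] -/
theorem kill_step (hrow : ∀ a b, (fun i : Fin 3 => (((a : Fin 3 → ℤ) i : ℤ) : ℂ)) ᵥ* Q a b = 0) (hcol : ∀ a b, Q a b *ᵥ (fun i : Fin 3 => (((b : Fin 3 → ℤ) i : ℤ) : ℂ)) = 0)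
    (hpol : (∀ (k₁ k₂ k₃ : Fin 3 → ℤ) (v₁ v₂ v₃ : Fin 3 → ℂ), ((k₁ : Fin 3 → ℤ) ≠ 0 ∧ (k₁) ⬝ᵥ (k₁) ≤ ((N : ℕ) : ℤ) ^ 2) → ((k₂ : Fin 3 → ℤ) ≠ 0 ∧ (k₂) ⬝ᵥ (k₂) ≤ ((N : ℕ) : ℤ) ^ 2) → ((k₃ : Fin 3 → ℤ) ≠ 0 ∧ (k₃) ⬝ᵥ (k₃) ≤ ((N : ℕ) : ℤ) ^ 2) → v₁ ⬝ᵥ (fun i : Fin 3 => (((k₁ : Fin 3 → ℤ) i : ℤ) : ℂ)) = 0 → v₂ ⬝ᵥ (fun i : Fin 3 => (((k₂ : Fin 3 → ℤ) i : ℤ) : ℂ)) = 0 → v₃ ⬝ᵥ (fun i : Fin 3 => (((k₃ : Fin 3 → ℤ) i : ℤ) : ℂ)) = 0 → (((v₁) ⬝ᵥ (fun i : Fin 3 => (((k₂ : Fin 3 → ℤ) i : ℤ) : ℂ))) • (v₂) + ((v₂) ⬝ᵥ (fun i : Fin 3 => (((k₁ : Fin 3 → ℤ) i : ℤ) : ℂ)))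 • (v₁) : Fin 3 → ℂ) ⬝ᵥ (Q (k₁ + k₂) k₃ *ᵥ v₃) + (((v₁) ⬝ᵥ (fun i : Fin 3 => (((k₃ : Fin 3 → ℤ) i : ℤ) : ℂ))) • (v₃) + ((v₃) ⬝ᵥ (fun i : Fin 3 => (((k₁ : Fin 3 → ℤ) i : ℤ) : ℂ))) • (v₁) : Fin 3 → ℂ) ⬝ᵥ (Q (k₁ + k₃) k₂ *ᵥ v₂) + (((v₂) ⬝ᵥ (fun i : Fin 3 => (((k₃ : Fin 3 → ℤ) i : ℤ) : ℂ))) • (v₃) + ((v₃) ⬝ᵥ (fun i : Fin 3 => (((k₂ : Fin 3 → ℤ) i : ℤ) : ℂ))) • (v₂) : Fin 3 → ℂ) ⬝ᵥ (Q (k₂ + k₃) k₁ *ᵥ v₁) = 0)) {k₁ k₂ b : Fin 3 → ℤ} (hk₁ : ((k₁ : Fin 3 → ℤ) ≠ 0 ∧ (k₁) ⬝ᵥ (k₁) ≤ ((N : ℕ) : ℤ) ^ 2)) (hk₂ : ((k₂ : Fin 3 → ℤ) ≠ 0 ∧ (k₂) ⬝ᵥ (k₂) ≤ ((N : ℕ)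 : ℤ) ^ 2)) (hb : ((b : Fin 3 → ℤ) ≠ 0 ∧ (b) ⬝ᵥ (b) ≤ ((N : ℕ) : ℤ) ^ 2))
    (hn : k₁ ⨯₃ k₂ ≠ 0) (hlen : k₁ ⬝ᵥ k₁ ≠ k₂ ⬝ᵥ k₂) (hd₁ : Q (k₁ + b) k₂ = 0)
    (hd₂ : Q (k₂ + b) k₁ = 0) : Q (k₁ + k₂) b = 0 := by
  refine matrix_eq_zero_of_forall_pair_transfer k₁ k₂ b hn hlen hb.1 _ (hrow _ _) (hcol _ _)
    fun x y w hx hy hw => ?_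
  have h := hpol k₁ k₂ b x y w hk₁ hk₂ hb hx hy hw
  rwa [hd₁, hd₂, Matrix.zero_mulVec, Matrix.zero_mulVec, dotProduct_zero, dotProduct_zero, add_zero,
    add_zero] at h

/-- Transposed blocks die together. [folklore] -/
theorem eq_zero_of_transpose (hsymm : ∀ a b, Q b a = (Q a b)ᵀ) {a b : Fin 3 → ℤ} (h : Q b a = 0) :
    Q a b = 0 := by
  have := hsymm b a
  rw [h] at this
  rw [this, Matrix.transpose_zero]

/-- **A0 — no equilateral pair on the axis.** `x² + z² = 3 j²` has no integer solution with `j ≠ 0`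
(`v₃` of a sum of two squares is even, `v₃(3j²)` is odd). Copied from the line skeleton
`Cruxes/QuarticGate/Lines/axis-sectors.lean` (planner's orphan `noEquilateralOnAxis`). [folklore] -/
theorem no_three_sq {j : ℤ} (hj : j ≠ 0) (x z : ℤ) : x ^ 2 + z ^ 2 ≠ 3 * j ^ 2 := by
  intro h
  have hN : x.natAbs ^ 2 + z.natAbs ^ 2 = 3 * j.natAbs ^ 2 := by
    have h2 := congrArg Int.natAbs h
    rw [Int.natAbs_add_of_nonneg (sq_nonneg x) (sq_nonneg z)] at h2
    simpa [Int.natAbs_mul, Int.natAbs_pow] using h2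
  have hj' : j.natAbs ≠ 0 := by simpa using hj
  set n : ℕ := 3 * j.natAbs ^ 2 with hn
  have hn0 : n ≠ 0 := Nat.mul_ne_zero (by norm_num) (pow_ne_zero 2 hj')
  have h3 : (3 : ℕ) ∈ n.primeFactors :=
    Nat.mem_primeFactors.mpr ⟨Nat.prime_three, ⟨j.natAbs ^ 2, hn⟩, hn0⟩
  have heven : Even (padicValNat 3 n) :=
    (Nat.eq_sq_add_sq_iff.mp ⟨x.natAbs, z.natAbs, hN.symm⟩) 3 h3 (by norm_num)
  have hodd : padicValNat 3 n = 1 + 2 * padicValNat 3 j.natAbs := by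
    haveI : Fact (Nat.Prime 3) := ⟨Nat.prime_three⟩
    rw [hn, padicValNat.mul (by norm_num) (by positivity), padicValNat_self, padicValNat.pow]
  rw [hodd] at heven
  rcases heven with ⟨r, hr⟩
  omega

/-- **No equilateral pair in an axial sector**: for `θ = (0, m, 0) ≠ 0` and `a + b = θ`, the
three lengths `|a|, |b|, |θ|` cannot all be equal. [folklore] -/
theorem no_equilateral_on_axis {θ a b : Fin 3 → ℤ} (hθ0 : θ 0 = 0) (hθ2 : θ 2 = 0) (hθ : θ ≠ 0)
    (hab : a + b = θ) (ha : a ⬝ᵥ a = θ ⬝ᵥ θ) (hb : b ⬝ᵥ b = θ ⬝ᵥ θ) : False := by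
  have hm : θ 1 ≠ 0 := fun h => hθ (funext fun i => by fin_cases i <;> assumption)
  have hb' : b = θ - a := by rw [← hab]; abel
  rw [hb', vec3_dotProduct, vec3_dotProduct] at hb
  rw [vec3_dotProduct, vec3_dotProduct] at ha
  simp only [Pi.sub_apply, hθ0, hθ2, zero_sub, mul_neg, neg_mul, neg_neg, zero_mul, add_zero,
    zero_add] at ha hb
  -- `2 m a₁ = m²`, so `m = 2 a₁`, and `a₀² + a₂² = 3 a₁²`
  have h1 : θ 1 = 2 * a 1 := by
    have : θ 1 * (θ 1 - 2 * a 1) = 0 := by nlinarith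
    rcases mul_eq_zero.1 this with h | h
    · exact absurd h hm
    · linarith
  have h3 : a 0 ^ 2 + a 2 ^ 2 = 3 * a 1 ^ 2 := by rw [h1] at ha; nlinarith
  have ha1 : a 1 ≠ 0 := fun h => hm (by rw [h1, h, mul_zero])
  exact no_three_sq ha1 (a 0) (a 2) h3

/-- Self dot products of integer vectors are nonnegative. [folklore] -/
theorem dotProduct_self_nonneg_int (v : Fin 3 → ℤ) : 0 ≤ v ⬝ᵥ v := by
  rw [vec3_dotProduct]; nlinarith [mul_self_nonneg (v 0), mul_self_nonneg (v 1), mul_self_nonneg (v 2)]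

/-- Lagrange: a non-collinear pair is strictly inside Cauchy–Schwarz. [folklore] -/
theorem dot_sq_lt_of_cross_ne_zero {a c : Fin 3 → ℤ} (h : a ⨯₃ c ≠ 0) :
    (a ⬝ᵥ c) * (a ⬝ᵥ c) < (a ⬝ᵥ a) * (c ⬝ᵥ c) := by
  have hpos := dotProduct_self_pos_of_ne_zero_int h
  rw [cross_dot_cross, dotProduct_comm c a] at hpos
  linarith

/-- Exteriority bound: for `a, θ` in the ball of radius `N`, `|2a - θ|² ≤ 9N²`. [folklore] -/
theorem exteriority_le {θ a : Fin 3 → ℤ} (hθ : ((θ : Fin 3 → ℤ) ≠ 0 ∧ (θ) ⬝ᵥ (θ) ≤ ((N : ℕ) : ℤ) ^ 2)) (ha : ((a : Fin 3 → ℤ) ≠ 0 ∧ (a) ⬝ᵥ (a) ≤ ((N : ℕ) : ℤ) ^ 2)) :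
    (2 • a - θ) ⬝ᵥ (2 • a - θ) ≤ 9 * ((N : ℕ) : ℤ) ^ 2 := by
  have h0 := dotProduct_self_nonneg_int (a + θ)
  have e1 : (2 • a - θ) ⬝ᵥ (2 • a - θ) = 4 * (a ⬝ᵥ a) - 4 * (a ⬝ᵥ θ) + θ ⬝ᵥ θ := by
    simp only [sub_dotProduct, dotProduct_sub, smul_dotProduct, dotProduct_smul, dotProduct_comm θ a]
    ring
  have e2 : (a + θ) ⬝ᵥ (a + θ) = a ⬝ᵥ a + 2 * (a ⬝ᵥ θ) + θ ⬝ᵥ θ := by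
    simp only [add_dotProduct, dotProduct_add, dotProduct_comm θ a]; ring
  rw [e1]; rw [e2] at h0
  linarith [ha.2, hθ.2]

/-- The exteriority gap of a two-mode link: `|θ + 2b|² - |θ - 2b|² = 8 b·θ`. [folklore] -/
theorem exteriority_link (θ b : Fin 3 → ℤ) :
    (2 • (θ + b) - θ) ⬝ᵥ (2 • (θ + b) - θ) = (2 • (θ - b) - θ) ⬝ᵥ (2 • (θ - b) - θ) + 8 * (b ⬝ᵥ θ) := by
  have e1 : 2 • (θ + b) - θ = θ + 2 • b := by
    ext i; simp only [Pi.sub_apply, Pi.add_apply, Pi.smul_apply]; ring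
  have e2 : 2 • (θ - b) - θ = θ - 2 • b := by
    ext i; simp only [Pi.sub_apply, Pi.smul_apply]; ring
  rw [e1, e2]
  simp only [sub_dotProduct, dotProduct_sub, add_dotProduct, dotProduct_add, smul_dotProduct,
    dotProduct_smul, dotProduct_comm θ b]
  ring

/-- **The two-mode link.** For `θ` in the punctured ball and a pair `a + b = θ` in the ball with
`b ∦ θ`, `|b| ≠ |θ|`: if the outer neighbour block `Q (θ + b) (-b)` is dead, then `Q a b = 0`
(`(POL)(-b, θ, b)`; the third block `Q 0 θ` is absent). [folklore] -/
theorem link_kill (hsupp : (∀ a b : Fin 3 → ℤ, ¬ (((a : Fin 3 → ℤ) ≠ 0 ∧ (a) ⬝ᵥ (a) ≤ ((N : ℕ) : ℤ) ^ 2) ∧ ((b : Fin 3 → ℤ) ≠ 0 ∧ (b) ⬝ᵥ (b) ≤ ((N : ℕ) : ℤ) ^ 2)) → Q a b = 0)) (hrow : ∀ a b, (fun i : Fin 3 => (((a : Fin 3 → ℤ) i : ℤ) : ℂ)) ᵥ* Q a b = 0)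
    (hcol : ∀ a b, Q a b *ᵥ (fun i : Fin 3 => (((b : Fin 3 → ℤ) i : ℤ) : ℂ)) = 0) (hpol : (∀ (k₁ k₂ k₃ : Fin 3 → ℤ) (v₁ v₂ v₃ : Fin 3 → ℂ), ((k₁ : Fin 3 → ℤ) ≠ 0 ∧ (k₁) ⬝ᵥ (k₁) ≤ ((N : ℕ) : ℤ) ^ 2) → ((k₂ : Fin 3 → ℤ) ≠ 0 ∧ (k₂) ⬝ᵥ (k₂) ≤ ((N : ℕ) : ℤ) ^ 2) → ((k₃ : Fin 3 → ℤ) ≠ 0 ∧ (k₃) ⬝ᵥ (k₃) ≤ ((N : ℕ) : ℤ) ^ 2) → v₁ ⬝ᵥ (fun i : Fin 3 => (((k₁ : Fin 3 → ℤ) i : ℤ) : ℂ)) = 0 → v₂ ⬝ᵥ (fun i : Fin 3 => (((k₂ : Fin 3 → ℤ) i : ℤ) : ℂ)) = 0 → v₃ ⬝ᵥ (fun i : Fin 3 => (((k₃ : Fin 3 → ℤ) i : ℤ) : ℂ)) = 0 → (((v₁) ⬝ᵥ (fun i : Fin 3 => (((k₂ : Fin 3 → ℤ) i : ℤ) : ℂ)))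 • (v₂) + ((v₂) ⬝ᵥ (fun i : Fin 3 => (((k₁ : Fin 3 → ℤ) i : ℤ) : ℂ))) • (v₁) : Fin 3 → ℂ) ⬝ᵥ (Q (k₁ + k₂) k₃ *ᵥ v₃) + (((v₁) ⬝ᵥ (fun i : Fin 3 => (((k₃ : Fin 3 → ℤ) i : ℤ) : ℂ))) • (v₃) + ((v₃) ⬝ᵥ (fun i : Fin 3 => (((k₁ : Fin 3 → ℤ) i : ℤ) : ℂ))) • (v₁) : Fin 3 → ℂ) ⬝ᵥ (Q (k₁ + k₃) k₂ *ᵥ v₂) + (((v₂) ⬝ᵥ (fun i : Fin 3 => (((k₃ : Fin 3 → ℤ) i : ℤ) : ℂ))) • (v₃) + ((v₃) ⬝ᵥ (fun i : Fin 3 => (((k₂ : Fin 3 → ℤ) i : ℤ) : ℂ))) • (v₂) : Fin 3 → ℂ) ⬝ᵥ (Q (k₂ + k₃) k₁ *ᵥ v₁) = 0)) {θ a b : Fin 3 → ℤ} (hθ : ((θ : Fin 3 → ℤ) ≠ 0 ∧ (θ) ⬝ᵥ (θ) ≤ ((N : ℕ) : ℤ) ^ 2))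
    (hab : a + b = θ) (hb : ((b : Fin 3 → ℤ) ≠ 0 ∧ (b) ⬝ᵥ (b) ≤ ((N : ℕ) : ℤ) ^ 2)) (hbnc : b ⨯₃ θ ≠ 0) (hlen : b ⬝ᵥ b ≠ θ ⬝ᵥ θ)
    (hdead : Q (θ + b) (-b) = 0) : Q a b = 0 := by
  have e : -b + θ = a := by rw [← hab]; abel
  have h := kill_step Q hrow hcol hpol (k₁ := -b) (k₂ := θ) (b := b) (ball_neg hb) hθ hb
    (by rwa [LinearMap.map_neg₂, neg_ne_zero]) (by simpa using hlen)
    (by rw [neg_add_cancel]; exact hsupp 0 θ fun h => h.1.1 rfl) hdead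
  rwa [e] at h

/-- **The lens, `θ` in the ball: every non-collinear pair dies.** For an axial `θ = (0,m,0)`,
`θ ≠ 0`, in the punctured ball, `Q a b = 0` whenever `a + b = θ` and `a ∦ θ`: downward
induction on the exteriority `|2a - θ|²` along the two-mode links, which conduct unless
`|b| = |θ|`; a two-sided stall would be an equilateral pair, impossible on the axis. [folklore] -/
theorem offcentre_noncollinear_of_mem (hsupp : (∀ a b : Fin 3 → ℤ, ¬ (((a : Fin 3 → ℤ) ≠ 0 ∧ (a) ⬝ᵥ (a) ≤ ((N : ℕ) : ℤ) ^ 2) ∧ ((b : Fin 3 → ℤ) ≠ 0 ∧ (b) ⬝ᵥ (b) ≤ ((N : ℕ) : ℤ) ^ 2)) → Q a b = 0)) (hsymm : ∀ a b, Q b a = (Q a b)ᵀ)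
    (hrow : ∀ a b, (fun i : Fin 3 => (((a : Fin 3 → ℤ) i : ℤ) : ℂ)) ᵥ* Q a b = 0) (hcol : ∀ a b, Q a b *ᵥ (fun i : Fin 3 => (((b : Fin 3 → ℤ) i : ℤ) : ℂ)) = 0) (hpol : (∀ (k₁ k₂ k₃ : Fin 3 → ℤ) (v₁ v₂ v₃ : Fin 3 → ℂ), ((k₁ : Fin 3 → ℤ) ≠ 0 ∧ (k₁) ⬝ᵥ (k₁) ≤ ((N : ℕ) : ℤ) ^ 2) → ((k₂ : Fin 3 → ℤ) ≠ 0 ∧ (k₂) ⬝ᵥ (k₂) ≤ ((N : ℕ) : ℤ) ^ 2) → ((k₃ : Fin 3 → ℤ) ≠ 0 ∧ (k₃) ⬝ᵥ (k₃) ≤ ((N : ℕ) : ℤ) ^ 2) → v₁ ⬝ᵥ (fun i : Fin 3 => (((k₁ : Fin 3 → ℤ) i : ℤ) : ℂ)) = 0 → v₂ ⬝ᵥ (fun i : Fin 3 => (((k₂ : Fin 3 → ℤ) i : ℤ) : ℂ)) = 0 → v₃ ⬝ᵥ (fun i : Fin 3 => (((k₃ : Fin 3 → ℤ) i : ℤ)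 : ℂ)) = 0 → (((v₁) ⬝ᵥ (fun i : Fin 3 => (((k₂ : Fin 3 → ℤ) i : ℤ) : ℂ))) • (v₂) + ((v₂) ⬝ᵥ (fun i : Fin 3 => (((k₁ : Fin 3 → ℤ) i : ℤ) : ℂ))) • (v₁) : Fin 3 → ℂ) ⬝ᵥ (Q (k₁ + k₂) k₃ *ᵥ v₃) + (((v₁) ⬝ᵥ (fun i : Fin 3 => (((k₃ : Fin 3 → ℤ) i : ℤ) : ℂ))) • (v₃) + ((v₃) ⬝ᵥ (fun i : Fin 3 => (((k₁ : Fin 3 → ℤ) i : ℤ) : ℂ))) • (v₁) : Fin 3 → ℂ) ⬝ᵥ (Q (k₁ + k₃) k₂ *ᵥ v₂) + (((v₂) ⬝ᵥ (fun i : Fin 3 => (((k₃ : Fin 3 → ℤ) i : ℤ) : ℂ))) • (v₃) + ((v₃) ⬝ᵥ (fun i : Fin 3 => (((k₂ : Fin 3 → ℤ) i : ℤ) : ℂ))) • (v₂) : Fin 3 → ℂ) ⬝ᵥ (Q (k₂ + k₃) k₁ *ᵥ v₁) = 0))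
    {θ : Fin 3 → ℤ} (hθ0 : θ 0 = 0) (hθ2 : θ 2 = 0) (hθ : ((θ : Fin 3 → ℤ) ≠ 0 ∧ (θ) ⬝ᵥ (θ) ≤ ((N : ℕ) : ℤ) ^ 2))
    (a b : Fin 3 → ℤ) (hab : a + b = θ) (hnc : a ⨯₃ θ ≠ 0) : Q a b = 0 := by
  set B : ℤ := 9 * ((N : ℕ) : ℤ) ^ 2 with hB
  suffices H : ∀ n : ℕ, ∀ a b : Fin 3 → ℤ, a + b = θ → a ⨯₃ θ ≠ 0 →
      B - (2 • a - θ) ⬝ᵥ (2 • a - θ) ≤ n → Q a b = 0 from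
    H _ a b hab hnc (Int.self_le_toNat _)
  intro n
  induction n using Nat.strong_induction_on with
  | _ n ih =>
  intro a b hab hnc hn
  by_cases hmem : ((a : Fin 3 → ℤ) ≠ 0 ∧ (a) ⬝ᵥ (a) ≤ ((N : ℕ) : ℤ) ^ 2) ∧ ((b : Fin 3 → ℤ) ≠ 0 ∧ (b) ⬝ᵥ (b) ≤ ((N : ℕ) : ℤ) ^ 2)
  swap
  · exact hsupp a b hmem
  obtain ⟨ha, hb⟩ := hmem
  -- the induction hypothesis: more exterior non-collinear pairs are dead
  have ih' : ∀ a' b' : Fin 3 → ℤ, a' + b' = θ → a' ⨯₃ θ ≠ 0 →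
      (2 • a - θ) ⬝ᵥ (2 • a - θ) < (2 • a' - θ) ⬝ᵥ (2 • a' - θ) → Q a' b' = 0 := by
    intro a' b' hab' hnc' hlt
    by_cases hmem' : ((a' : Fin 3 → ℤ) ≠ 0 ∧ (a') ⬝ᵥ (a') ≤ ((N : ℕ) : ℤ) ^ 2) ∧ ((b' : Fin 3 → ℤ) ≠ 0 ∧ (b') ⬝ᵥ (b') ≤ ((N : ℕ) : ℤ) ^ 2)
    swap
    · exact hsupp a' b' hmem'
    have hle := exteriority_le hθ hmem'.1
    have h0 : 0 ≤ B - (2 • a' - θ) ⬝ᵥ (2 • a' - θ) := by rw [hB]; linarith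
    refine ih (B - (2 • a' - θ) ⬝ᵥ (2 • a' - θ)).toNat ?_ a' b' hab' hnc' (by rw [Int.toNat_of_nonneg h0])
    have : ((B - (2 • a' - θ) ⬝ᵥ (2 • a' - θ)).toNat : ℤ) < n := by
      rw [Int.toNat_of_nonneg h0]; linarith
    exact_mod_cast this
  have hbnc : b ⨯₃ θ ≠ 0 := by
    have : b = θ - a := by rw [← hab]; abel
    rw [this, LinearMap.map_sub₂, cross_self, zero_sub, neg_ne_zero]; exact hnc
  have hsum : a ⬝ᵥ θ + b ⬝ᵥ θ = θ ⬝ᵥ θ := by rw [← add_dotProduct, hab]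
  have hθpos : 0 < θ ⬝ᵥ θ := dotProduct_self_pos_of_ne_zero_int hθ.1
  have hLa := dot_sq_lt_of_cross_ne_zero hnc
  have hLb := dot_sq_lt_of_cross_ne_zero hbnc
  have hb' : b = θ - a := by rw [← hab]; abel
  have ha' : a = θ - b := by rw [← hab]; abel
  by_cases h1 : 0 < b ⬝ᵥ θ ∧ b ⬝ᵥ b ≠ θ ⬝ᵥ θ
  · refine link_kill Q hsupp hrow hcol hpol hθ hab hb hbnc h1.2 (ih' (θ + b) (-b) (by abel) ?_ ?_)
    · rwa [LinearMap.map_add₂, cross_self, zero_add]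
    · rw [exteriority_link, ← ha']; linarith [h1.1]
  by_cases h2 : 0 < a ⬝ᵥ θ ∧ a ⬝ᵥ a ≠ θ ⬝ᵥ θ
  · apply eq_zero_of_transpose Q hsymm
    refine link_kill Q hsupp hrow hcol hpol hθ ((add_comm b a).trans hab) ha hnc h2.2
      (ih' (θ + a) (-a) (by abel) ?_ ?_)
    · rwa [LinearMap.map_add₂, cross_self, zero_add]
    · rw [exteriority_link, ← hb']
      have : (2 • b - θ) ⬝ᵥ (2 • b - θ) = (2 • a - θ) ⬝ᵥ (2 • a - θ) := by
        rw [hb']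
        have e : 2 • (θ - a) - θ = -(2 • a - θ) := by
          ext i; simp only [Pi.sub_apply, Pi.neg_apply, Pi.smul_apply]; ring
        rw [e, neg_dotProduct_neg]
      linarith [h2.1]
  -- the stall: both links blocked is impossible
  exfalso
  push Not at h1 h2
  rcases le_or_gt (b ⬝ᵥ θ) 0 with hb0 | hb0
  · have haa := h2 (by linarith)
    nlinarith
  · have hbb := h1 hb0
    rcases le_or_gt (a ⬝ᵥ θ) 0 with ha0 | ha0
    · nlinarith
    · exact no_equilateral_on_axis hθ0 hθ2 hθ.1 hab (h2 ha0) hbb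

end Summit.AnomalousDissipation.AnomalousDissipation.Theorems.MomentParityQuarticGate.AxialQuad

namespace Summit.AnomalousDissipation.AnomalousDissipation.Theorems.MomentParityQuarticGate

-- the summit-side namespace repeats `AnomalousDissipation` by the tree's convention
set_option linter.dupNamespace false in
/-- **Registered sub-goal `axialQuad_offA` of stub S2q** (summary of this file): for an axial `θ` in the punctured ball, every block of a non-collinear pair `a + b = θ` vanishes. [folklore] -/
theorem axialQuad_offA : ∀ (Q : ((Fin 3 → ℤ) → (Fin 3 → ℤ) → Matrix (Fin 3) (Fin 3) ℂ)) (N : ℕ), (∀ a b : Fin 3 → ℤ, ¬ (((a : Fin 3 → ℤ) ≠ 0 ∧ (a) ⬝ᵥ (a) ≤ ((N : ℕ) : ℤ) ^ 2) ∧ ((b : Fin 3 → ℤ) ≠ 0 ∧ (b) ⬝ᵥ (b) ≤ ((N : ℕ) : ℤ) ^ 2)) → Q a b = 0) → (∀ a b : Fin 3 → ℤ, Q b a = Matrix.transpose (Q a b)) → (∀ a b : Fin 3 → ℤ, Matrix.vecMul (fun i : Fin 3 => (((a : Fin 3 → ℤ) i : ℤ) : ℂ)) (Q a b) = 0) → (∀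 a b : Fin 3 → ℤ, Matrix.mulVec (Q a b) (fun i : Fin 3 => (((b : Fin 3 → ℤ) i : ℤ) : ℂ)) = 0) → (∀ (k₁ k₂ k₃ : Fin 3 → ℤ) (v₁ v₂ v₃ : Fin 3 → ℂ), ((k₁ : Fin 3 → ℤ) ≠ 0 ∧ (k₁) ⬝ᵥ (k₁) ≤ ((N : ℕ) : ℤ) ^ 2) → ((k₂ : Fin 3 → ℤ) ≠ 0 ∧ (k₂) ⬝ᵥ (k₂) ≤ ((N : ℕ) : ℤ) ^ 2) → ((k₃ : Fin 3 → ℤ) ≠ 0 ∧ (k₃) ⬝ᵥ (k₃) ≤ ((N : ℕ) : ℤ) ^ 2) → v₁ ⬝ᵥ (fun i : Fin 3 => (((k₁ : Fin 3 → ℤ) i : ℤ) : ℂ)) = 0 → v₂ ⬝ᵥ (fun i : Fin 3 => (((k₂ : Fin 3 → ℤ) i : ℤ) : ℂ)) = 0 → v₃ ⬝ᵥ (fun i : Fin 3 => (((k₃ : Fin 3 → ℤ) i : ℤ) : ℂ)) = 0 → (((v₁) ⬝ᵥ (fun i : Fin 3 => (((k₂ : Fin 3 → ℤ) i : ℤ)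 : ℂ))) • (v₂) + ((v₂) ⬝ᵥ (fun i : Fin 3 => (((k₁ : Fin 3 → ℤ) i : ℤ) : ℂ))) • (v₁) : Fin 3 → ℂ) ⬝ᵥ (Matrix.mulVec (Q (k₁ + k₂) k₃) v₃) + (((v₁) ⬝ᵥ (fun i : Fin 3 => (((k₃ : Fin 3 → ℤ) i : ℤ) : ℂ))) • (v₃) + ((v₃) ⬝ᵥ (fun i : Fin 3 => (((k₁ : Fin 3 → ℤ) i : ℤ) : ℂ))) • (v₁) : Fin 3 → ℂ) ⬝ᵥ (Matrix.mulVec (Q (k₁ + k₃) k₂) v₂) + (((v₂) ⬝ᵥ (fun i : Fin 3 => (((k₃ : Fin 3 → ℤ) i : ℤ) : ℂ))) • (v₃) + ((v₃) ⬝ᵥ (fun i : Fin 3 => (((k₂ : Fin 3 → ℤ) i : ℤ) : ℂ))) • (v₂) : Fin 3 → ℂ) ⬝ᵥ (Matrix.mulVec (Q (k₂ + k₃) k₁) v₁) = 0) → ∀ (θ : Fin 3 → ℤ), θ 0 = 0 → θ 2 = 0 → ((θ : Fin 3 → ℤ) ≠ 0 ∧ (θ) ⬝ᵥ (θ) ≤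 ((N : ℕ) : ℤ) ^ 2) → ∀ (a b : Fin 3 → ℤ), a + b = θ → crossProduct a θ ≠ 0 → Q a b = 0 :=
  fun Q _ hsupp hsymm hrow hcol hpol _ hθ0 hθ2 hθ a b hab hnc => AxialQuad.offcentre_noncollinear_of_mem Q hsupp hsymm hrow hcol hpol hθ0 hθ2 hθ a b hab hnc

end Summit.AnomalousDissipation.AnomalousDissipation.Theorems.MomentParityQuarticGate
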